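import Summits.QuantumFields.BalabanUV.T4Continuum.Support.NE7AxialGaugeGradient
import Literature.MathematicalPhysics.QuantumFieldTheory.Balaban1983to89.MatrixLogLipschitz
import Summits.QuantumFields.BalabanUV.T4Continuum.Support.UnitaryRootInterpolation
import HarnessLib

/-!
# NE7AxialChartCube — THE LOCAL CHART ON A CUBE FROM PLAQUETTE DATA: the cut-off logarithm `A = χ·log W₀` of the axial gauge is skew, supported in the
# cube of radius `R′`, with `‖A‖ ≤ 4(d+1)(R′+1)·x`, `‖A(p + e_τ, μ) − A(p, μ)‖ ≤ (4∕3)·g₁ + 4(d+1)(R′+1)x∕M_w` EVERYWHERE and `e^{A} = W₀` on the inner cube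
# (`g₁ = 2(d+1)(R′+2)x₁ + 16(d+1)²(R′+2)²x² + 2x` the axial gradient of F289, `M_w` the collar width)

Cell `pub-balaban`, rung (B)+1 sub-cell t4, lineage `b2b-balaban-t4-ne7-p1` (CRUX PROVER NE7 #1 = OWNER of row NE7), generation 91; memo
`t4/b2b-balaban-t4-ne7-p1-g91/COVER-OBSTRUCTION.md` §3.  Over F289 `NE7AxialGaugeGradient` (the all-directions axial gradient on a cube), the axial sup letter
(`B8Lemma1NonAbelian.axial_bond_bound_sharp`) and lit-balaban's logarithm (`MatrixLog.exp_mlog`, `norm_mlog_le_two_mul`, `MatrixLogLipschitz.norm_mlog_sub_mlog_le`,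
`B7Prop2Explicit.star_mlog_eq_neg`).

WHY.  THE CHART of row NE7 (the `hchart` binder of `NE7HintOfLocalChartSU2Wide.hint_of_localChart_SU2_wide`) wants a GLOBALLY defined skew potential `At` with GLOBAL sup
and gradient letters and `U^{u} = e^{At}` on a ball.  This file produces the non-periodic core on `ℤ^{d+1}`: from the plaquette radius `x` and the covariant
plaquette-gradient radius `x₁` of ANY unitary configuration, the axial gauge `W₀ = W^{axialFn W (y₀ − (R′+1)𝟙)}` on the cube of radius `R′` about `y₀`, cut off
by the piecewise-linear profile `χ(p) = max(0, min(1, (R′ − |p − y₀|_∞)∕M_w))` (Lipschitz `1∕M_w`, `= 1` on the inner cube of radius `R′ − M_w`, `= 0` off the cube):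
`A := χ·log W₀`.  With `R′ ≍ ℓM`, `M_w = M`, `x = t∕M²`, `x₁ ≍ t∕M³`: `M‖A‖ ≲ (d+1)ℓ·t`, `M²‖∇A‖ ≲ (d+1)ℓ·t` — THE CHART's two currencies with constants polynomial
in `ℓ`, from the ONE regularity datum `x₁` ([Balaban1985Variational] Thm 1 (9)–(10) TYPE for the tangent-critical minimiser; NOT proved here).  The successor
file periodises (`u`, `At` on the torus) and docks into the `hchart` binder.
WHAT ([folklore]; 0 def, 0 sorry; dimension `d + 1`).  §1 the sup-distance `D(p) = max_i |p_i − y₀,i|` and the cut-off profile (inline, no definition): range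
`[0,1]`, plateau, support, Lipschitz `1∕M_w`.  §2 the cube letters of `W₀` (sup `2(d+1)(R′+1)x` on the `(R′+1)`-cube, gradient `g₁` on the `R′`-cube — F289).
§3 **`exists_axialChart_cube`**: `∃ A`, skew everywhere, `= 0` off the `R′`-cube, `‖A‖ ≤ 4(d+1)(R′+1)x`, `‖A(p+e_τ,μ) − A(p,μ)‖ ≤ (4∕3)g₁ + 4(d+1)(R′+1)x∕M_w`
everywhere, `exp A = W₀` on the `(R′ − M_w)`-cube; under `2(d+1)(R′+1)x ≤ 1∕4`.

HONEST FRAMING (page 1): kinematics of an arbitrary unitary lattice configuration + the matrix logarithm; the datum `x₁` is a HYPOTHESIS; THE CHART (periodic form),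
(APE) and NE7 NOT proved here; nothing of Bałaban's asserted; spine 0∕9; finite T⁴ rung (B)+1 — NOT infinite volume, NOT mass gap, NOT `BetaPertH`, NOT Clay.
Continuum YM on T⁴ ⇐ BetaPertH ∧ nine spine estimates (0/9 proved); BetaPertH ⇐ (D1) ∧ (D4) ∧ CAP+tail; G-an2-4 gates asym, D1 and NE2/3/4.  No `sorry`; axioms ⊆
{propext, Classical.choice, Quot.sound}.  PLACEMENT: our lemma, under `Summits/QuantumFields/BalabanUV/`.
-/

set_option autoImplicit false

open scoped BigOperators Matrix Matrix.Norms.L2Operator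
open NormedSpace Finset

namespace Summit.QuantumFields.BalabanUV.T4Continuum.NE7AxialChartCube

open Literature.MathematicalPhysics.QuantumFieldTheory.Balaban1983to89
open B7Prop1Explicit B7Prop2Explicit MatrixLog
open MatrixLogLipschitz (norm_mlog_sub_mlog_le)
open B8Lemma1NonAbelian (lowPart axial_bond_bound_sharp PlaqSmall)
open B8Ineq129 (l1_lowPart_le)
open T4AveragingDeficitWall (Ad IsUnitaryCfg SmallField)
open AveragingDeficitTransport (mem_U1_of_unitary)
open NE7AxialGaugeGradient (norm_axial_shift_le_cube)

noncomputable section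

variable {d : ℕ} {n : Type*} [Fintype n] [DecidableEq n]

/-! ## §1 The sup-distance to the centre and the cut-off profile -/

/-- Each coordinate distance is at most the sup-distance. [folklore] -/
theorem abs_sub_le_supDist (y₀ p : Site (d + 1)) (i : Fin (d + 1)) :
    |p i - y₀ i| ≤ Finset.univ.sup' Finset.univ_nonempty (fun j => |p j - y₀ j|) :=
  Finset.le_sup' (fun j => |p j - y₀ j|) (Finset.mem_univ i)

/-- The sup-distance moves by at most one along a lattice step. [folklore] -/
theorem supDist_step_le (y₀ p : Site (d + 1)) (τ : Fin (d + 1)) :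
    Finset.univ.sup' Finset.univ_nonempty (fun j => |(p + e τ) j - y₀ j|) ≤ Finset.univ.sup' Finset.univ_nonempty (fun j => |p j - y₀ j|) + 1 ∧
    Finset.univ.sup' Finset.univ_nonempty (fun j => |p j - y₀ j|) ≤ Finset.univ.sup' Finset.univ_nonempty (fun j => |(p + e τ) j - y₀ j|) + 1 := by
  constructor
  · refine Finset.sup'_le _ _ fun j _ => ?_
    have h1 := abs_sub_le_supDist y₀ p j
    have h2 : |(p + e τ) j - y₀ j| ≤ |p j - y₀ j| + 1 := by
      rw [Pi.add_apply, e_apply]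
      split_ifs
      · calc |p j + 1 - y₀ j| = |(p j - y₀ j) + 1| := by ring_nf
          _ ≤ |p j - y₀ j| + |(1 : ℤ)| := abs_add_le _ _
          _ = |p j - y₀ j| + 1 := by simp
      · simp
    linarith
  · refine Finset.sup'_le _ _ fun j _ => ?_
    have h1 := abs_sub_le_supDist y₀ (p + e τ) j
    have h2 : |p j - y₀ j| ≤ |(p + e τ) j - y₀ j| + 1 := by
      rw [Pi.add_apply, e_apply]
      split_ifs
      · calc |p j - y₀ j| = |(p j + 1 - y₀ j) + (-1)| := by ring_nf
          _ ≤ |p j + 1 - y₀ j| + |(-1 : ℤ)| := abs_add_le _ _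
          _ = |p j + 1 - y₀ j| + 1 := by simp
      · simp
    linarith

/-- The cut-off profile `χ(D) = max(0, min(1, (R′ − D)∕M_w))` takes values in `[0, 1]`. [folklore] -/
theorem profile_mem_unitInterval (Rp Mw : ℝ) (D : ℝ) : 0 ≤ max 0 (min 1 ((Rp - D) / Mw)) ∧ max 0 (min 1 ((Rp - D) / Mw)) ≤ 1 :=
  ⟨le_max_left _ _, max_le zero_le_one (min_le_left _ _)⟩

/-- The profile is `1∕M_w`-Lipschitz in `D`. [folklore] -/
theorem abs_profile_sub_profile_le {Mw : ℝ} (hMw : 0 < Mw) (Rp D D' : ℝ) :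
    |max 0 (min 1 ((Rp - D) / Mw)) - max 0 (min 1 ((Rp - D') / Mw))| ≤ |D - D'| / Mw := by
  have h1 : |max 0 (min 1 ((Rp - D) / Mw)) - max 0 (min 1 ((Rp - D') / Mw))| ≤ |min 1 ((Rp - D) / Mw) - min 1 ((Rp - D') / Mw)| := by
    have := abs_max_sub_max_le_abs (min 1 ((Rp - D) / Mw)) (min 1 ((Rp - D') / Mw)) 0
    rwa [max_comm (min 1 ((Rp - D) / Mw)), max_comm (min 1 ((Rp - D') / Mw))] at this
  have h2 : |min 1 ((Rp - D) / Mw) - min 1 ((Rp - D') / Mw)| ≤ |(Rp - D) / Mw - (Rp - D') / Mw| := by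
    have := abs_min_sub_min_le_max 1 ((Rp - D) / Mw) 1 ((Rp - D') / Mw)
    simpa using this
  have h3 : |(Rp - D) / Mw - (Rp - D') / Mw| = |D - D'| / Mw := by
    rw [← sub_div, abs_div, abs_of_pos hMw, show Rp - D - (Rp - D') = -(D - D') by ring, abs_neg]
  linarith [h3.le]

/-! ## §2 The sup letter of the axial gauge on the cube -/

/-- In the axial gauge based at `y₀ − (R′+1)𝟙` every bond variable on the sup-cube of radius `R′ + 1` about `y₀` is within `2(d+1)(R′+1)·x` of `1`. [folklore] -/
theorem norm_axial_sub_one_le_cube [Nonempty n] {W : Site (d + 1) → Fin (d + 1) → (Matrix n n ℂ)ˣ} {x : ℝ} (hWu : IsUnitaryCfg W) (hx : 0 ≤ x) (hWx : SmallField W x)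
    (y₀ : Site (d + 1)) (R : ℕ) (z : Site (d + 1)) (ν : Fin (d + 1)) (hz : ∀ i, |z i - y₀ i| ≤ (R : ℤ) + 1) :
    ‖((gaugeAct (axialFn W (y₀ - fun _ => (R : ℤ) + 1)) W z ν : (Matrix n n ℂ)ˣ) : Matrix n n ℂ) - 1‖ ≤ 2 * ((d : ℝ) + 1) * (R + 1) * x := by
  set yb : Site (d + 1) := y₀ - fun _ => (R : ℤ) + 1 with hyb
  have hU1 : ∀ x' κ, W x' κ ∈ U1 (Matrix n n ℂ) := fun x' κ => mem_U1_of_unitary (hWu x' κ)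
  have hP : PlaqSmall W yb (z + e ν) x := fun x' κ₁ κ₂ hne _ _ => hWx x' κ₁ κ₂ hne
  have hyz : yb ≤ z := by
    intro i
    have h1 := (abs_le.mp (hz i)).1
    show y₀ i - ((R : ℤ) + 1) ≤ z i
    linarith
  have h := axial_bond_bound_sharp W hU1 hP yb z ν le_rfl hyz le_rfl
  refine h.trans ?_
  have h3 : l1 (lowPart ν (z - yb)) ≤ l1 (z - yb) := l1_lowPart_le ν _
  have h4 : l1 (z - yb) ≤ (d + 1) * (2 * R + 2) := by
    unfold l1
    calc ∑ i, ((z - yb) i).natAbs ≤ ∑ _i : Fin (d + 1), (2 * R + 2) := Finset.sum_le_sum fun i _ => by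
            have h1 := abs_le.mp (hz i)
            have e1 : (z - yb) i = z i - y₀ i + ((R : ℤ) + 1) := by rw [hyb]; simp; ring
            rw [e1]; omega
      _ = (d + 1) * (2 * R + 2) := by simp
  have h5 : (l1 (lowPart ν (z - yb)) : ℝ) ≤ 2 * ((d : ℝ) + 1) * (R + 1) := by
    have h6 : ((l1 (lowPart ν (z - yb)) : ℕ) : ℝ) ≤ (((d + 1) * (2 * R + 2) : ℕ) : ℝ) := by exact_mod_cast h3.trans h4
    refine h6.trans (le_of_eq ?_); push_cast; ring
  exact mul_le_mul_of_nonneg_right h5 hx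

/-! ## §3 The cut-off logarithmic chart on the cube -/

set_option maxHeartbeats 800000 in
/-- **THE LOCAL CHART ON A CUBE FROM PLAQUETTE DATA.**  For unitary `W` on `ℤ^{d+1}` with `SmallField W x`, covariant plaquette gradients `≤ x₁` in every direction,
a centre `y₀`, a cube radius `R′`, a collar width `1 ≤ M_w ≤ R′`, under `2(d+1)(R′+1)x ≤ 1∕4`: there is `A : ℤ^{d+1} → (directions → M_n(ℂ))` with
(i) `A(p, μ)` skew for all `p, μ`; (ii) `A(p, μ) = 0` unless `|p − y₀|_∞ ≤ R′`; (iii) `‖A(p, μ)‖ ≤ 4(d+1)(R′+1)x`; (iv) for ALL `p, μ, τ`: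
`‖A(p + e_τ, μ) − A(p, μ)‖ ≤ (4∕3)(2(d+1)(R′+2)x₁ + 16(d+1)²(R′+2)²x² + 2x) + 4(d+1)(R′+1)x∕M_w`; (v) `exp A(p, μ) = W₀(p, μ)` whenever `|p − y₀|_∞ ≤ R′ − M_w`,
`W₀ = W^{axialFn W (y₀ − (R′+1)𝟙)}`.  (`A = χ(|p − y₀|_∞)·log W₀(p, μ)` with the profile of §1.) [folklore] -/
theorem exists_axialChart_cube [Nonempty n] {W : Site (d + 1) → Fin (d + 1) → (Matrix n n ℂ)ˣ} (hWu : IsUnitaryCfg W) {x x₁ : ℝ} (hx0 : 0 ≤ x)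
    (hx10 : 0 ≤ x₁) (hWx : SmallField W x)
    (hgrad : ∀ (p : Site (d + 1)) (τ μ κ : Fin (d + 1)), κ ≠ μ →
      ‖Ad (W p τ) ((hol W (p + e τ) (plaqWord κ μ) : (Matrix n n ℂ)ˣ) : Matrix n n ℂ) - ((hol W p (plaqWord κ μ) : (Matrix n n ℂ)ˣ) : Matrix n n ℂ)‖ ≤ x₁)
    (y₀ : Site (d + 1)) (R' Mw : ℕ) (hMw : 1 ≤ Mw) (hMwR : Mw ≤ R') (hs : 2 * ((d : ℝ) + 1) * ((R' : ℝ) + 1) * x ≤ 1 / 4) :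
    ∃ A : Site (d + 1) → Fin (d + 1) → Matrix n n ℂ,
      (∀ (p : Site (d + 1)) (μ : Fin (d + 1)), A p μ ∈ skewAdjoint (Matrix n n ℂ)) ∧
      (∀ (p : Site (d + 1)) (μ : Fin (d + 1)), (∃ i, (R' : ℤ) < |p i - y₀ i|) → A p μ = 0) ∧
      (∀ (p : Site (d + 1)) (μ : Fin (d + 1)), ‖A p μ‖ ≤ 4 * ((d : ℝ) + 1) * ((R' : ℝ) + 1) * x) ∧
      (∀ (p : Site (d + 1)) (μ τ : Fin (d + 1)), ‖A (p + e τ) μ - A p μ‖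
        ≤ 4 / 3 * (2 * ((d : ℝ) + 1) * ((R' : ℝ) + 2) * x₁ + 16 * ((d : ℝ) + 1) ^ 2 * ((R' : ℝ) + 2) ^ 2 * x ^ 2 + 2 * x)
          + 4 * ((d : ℝ) + 1) * ((R' : ℝ) + 1) * x / Mw) ∧
      (∀ (p : Site (d + 1)) (μ : Fin (d + 1)), (∀ i, |p i - y₀ i| ≤ (R' : ℤ) - Mw) →
        exp (A p μ) = ((gaugeAct (axialFn W (y₀ - fun _ => (R' : ℤ) + 1)) W p μ : (Matrix n n ℂ)ˣ) : Matrix n n ℂ)) := by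
  -- names
  set W₀ : Site (d + 1) → Fin (d + 1) → (Matrix n n ℂ)ˣ := gaugeAct (axialFn W (y₀ - fun _ => (R' : ℤ) + 1)) W with hW₀
  set D : Site (d + 1) → ℤ := fun p => Finset.univ.sup' Finset.univ_nonempty (fun j => |p j - y₀ j|) with hD
  set χ : Site (d + 1) → ℝ := fun p => max 0 (min 1 (((R' : ℝ) - (D p : ℝ)) / (Mw : ℝ))) with hχ
  set s₀ : ℝ := 2 * ((d : ℝ) + 1) * ((R' : ℝ) + 1) * x with hs₀
  set g₁ : ℝ := 2 * ((d : ℝ) + 1) * ((R' : ℝ) + 2) * x₁ + 16 * ((d : ℝ) + 1) ^ 2 * ((R' : ℝ) + 2) ^ 2 * x ^ 2 + 2 * x with hg₁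
  have hMw0 : (0 : ℝ) < Mw := by exact_mod_cast hMw
  have hs₀0 : 0 ≤ s₀ := by rw [hs₀]; positivity
  have hg₁0 : 0 ≤ g₁ := by rw [hg₁]; positivity
  -- the unitary gauge
  have hau : ∀ z, axialFn W (y₀ - fun _ => (R' : ℤ) + 1) z ∈ unitaryUnits (Matrix n n ℂ) :=
    fun z => hol_mem_of (S := unitaryUnits (Matrix n n ℂ)) hWu _ _
  have hW₀u : IsUnitaryCfg W₀ := fun z κ =>
    (unitaryUnits _).mul_mem ((unitaryUnits _).mul_mem (hau z) (hWu z κ)) ((unitaryUnits _).inv_mem (hau _))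
  -- cube membership from the sup-distance
  have hDle : ∀ (p : Site (d + 1)) (c : ℤ), D p ≤ c → ∀ i, |p i - y₀ i| ≤ c := fun p c h i => (abs_sub_le_supDist y₀ p i).trans h
  have hDge : ∀ (p : Site (d + 1)) (c : ℤ), (∀ i, |p i - y₀ i| ≤ c) → D p ≤ c := fun p c h => Finset.sup'_le _ _ fun j _ => h j
  -- the letters of `W₀`
  have hsup : ∀ (p : Site (d + 1)) (μ : Fin (d + 1)), D p ≤ (R' : ℤ) + 1 → ‖(W₀ p μ : Matrix n n ℂ) - 1‖ ≤ s₀ := fun p μ hp => by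
    have h := norm_axial_sub_one_le_cube (d := d) hWu hx0 hWx y₀ R' p μ (hDle p _ hp)
    rw [hs₀]; exact h
  have hgr : ∀ (p : Site (d + 1)) (μ τ : Fin (d + 1)), D p ≤ (R' : ℤ) →
      ‖(W₀ (p + e τ) μ : Matrix n n ℂ) - (W₀ p μ : Matrix n n ℂ)‖ ≤ g₁ := fun p μ τ hp => by
    have h := norm_axial_shift_le_cube (d := d + 1) hWu hx0 hx10 hWx hgrad y₀ R' p (hDle p _ hp) τ μ
    rw [hg₁]; push_cast at h ⊢; linarith
  have hs₀q : s₀ ≤ 1 / 4 := hs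
  -- logarithms on the `(R′+1)`-cube
  have hlog_skew : ∀ (p : Site (d + 1)) (μ : Fin (d + 1)), D p ≤ (R' : ℤ) + 1 → mlog (W₀ p μ : Matrix n n ℂ) ∈ skewAdjoint (Matrix n n ℂ) :=
    fun p μ hp => by
      letI : NormedAlgebra ℚ (Matrix n n ℂ) := NormedAlgebra.restrictScalars ℚ ℝ (Matrix n n ℂ)
      letI : CStarAlgebra (Matrix n n ℂ) := {}
      have h1 := UnitaryRootInterpolation.smul_mlog_mem_skewAdjoint (mem_unitaryUnits.mp (hW₀u p μ)) ((hsup p μ hp).trans hs₀q) 1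
      rwa [one_smul] at h1
  have hlog_norm : ∀ (p : Site (d + 1)) (μ : Fin (d + 1)), D p ≤ (R' : ℤ) + 1 → ‖mlog (W₀ p μ : Matrix n n ℂ)‖ ≤ 2 * s₀ :=
    fun p μ hp => (norm_mlog_le_two_mul ((hsup p μ hp).trans (by linarith))).trans (by linarith [hsup p μ hp])
  have hlog_lip : ∀ (p : Site (d + 1)) (μ τ : Fin (d + 1)), D p ≤ (R' : ℤ) →
      ‖mlog (W₀ (p + e τ) μ : Matrix n n ℂ) - mlog (W₀ p μ : Matrix n n ℂ)‖ ≤ 4 / 3 * g₁ := fun p μ τ hp => by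
    have hp1 : D (p + e τ) ≤ (R' : ℤ) + 1 := (supDist_step_le y₀ p τ).1.trans (by linarith)
    have hp0 : D p ≤ (R' : ℤ) + 1 := hp.trans (by linarith)
    have h := norm_mlog_sub_mlog_le (r := 1 / 4) (by norm_num) ((hsup _ μ hp1).trans hs₀q) ((hsup p μ hp0).trans hs₀q)
    refine h.trans ?_
    rw [div_le_iff₀ (by norm_num : (0 : ℝ) < 1 - 1 / 4)]
    have := hgr p μ τ hp
    linarith
  -- the profile
  have hχ01 : ∀ p, 0 ≤ χ p ∧ χ p ≤ 1 := fun p => profile_mem_unitInterval _ _ _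
  have hχ1 : ∀ p : Site (d + 1), D p ≤ (R' : ℤ) - Mw → χ p = 1 := fun p hp => by
    have h1 : (1 : ℝ) ≤ ((R' : ℝ) - (D p : ℝ)) / (Mw : ℝ) := by
      rw [le_div_iff₀ hMw0, one_mul]
      have : ((D p : ℤ) : ℝ) ≤ ((R' : ℤ) : ℝ) - (Mw : ℝ) := by exact_mod_cast hp
      push_cast at this; linarith
    rw [hχ]; simp only
    rw [min_eq_left h1, max_eq_right zero_le_one]
  have hχ0 : ∀ p : Site (d + 1), (R' : ℤ) ≤ D p → χ p = 0 := fun p hp => by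
    have h1 : ((R' : ℝ) - (D p : ℝ)) / (Mw : ℝ) ≤ 0 := by
      apply div_nonpos_of_nonpos_of_nonneg _ hMw0.le
      have : ((R' : ℤ) : ℝ) ≤ ((D p : ℤ) : ℝ) := by exact_mod_cast hp
      push_cast at this; linarith
    rw [hχ]; simp only
    rw [max_eq_left (min_le_of_right_le h1)]
  have hχlip : ∀ (p : Site (d + 1)) (τ : Fin (d + 1)), |χ (p + e τ) - χ p| ≤ 1 / Mw := fun p τ => by
    have h := abs_profile_sub_profile_le hMw0 (R' : ℝ) (D (p + e τ) : ℝ) (D p : ℝ)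
    refine h.trans (div_le_div_of_nonneg_right ?_ hMw0.le)
    have h1 := supDist_step_le y₀ p τ
    rw [abs_le]
    constructor
    · have : ((D p : ℤ) : ℝ) ≤ ((D (p + e τ) : ℤ) : ℝ) + 1 := by exact_mod_cast h1.2
      linarith
    · have : ((D (p + e τ) : ℤ) : ℝ) ≤ ((D p : ℤ) : ℝ) + 1 := by exact_mod_cast h1.1
      linarith
  -- THE CHART
  refine ⟨fun p μ => χ p • mlog (W₀ p μ : Matrix n n ℂ), ?_, ?_, ?_, ?_, ?_⟩
  · -- (i) skew
    intro p μ
    by_cases hp : D p ≤ (R' : ℤ) + 1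
    · exact skewAdjoint.smul_mem _ (hlog_skew p μ hp)
    · have h0 : χ p = 0 := hχ0 p (by push Not at hp; linarith)
      simp only [h0, zero_smul]
      exact (skewAdjoint (Matrix n n ℂ)).zero_mem
  · -- (ii) support
    rintro p μ ⟨i, hi⟩
    have hDp : (R' : ℤ) ≤ D p := hi.le.trans (abs_sub_le_supDist y₀ p i)
    simp only [hχ0 p hDp, zero_smul]
  · -- (iii) sup
    intro p μ
    by_cases hp : D p ≤ (R' : ℤ) + 1
    · calc ‖χ p • mlog (W₀ p μ : Matrix n n ℂ)‖ = |χ p| * ‖mlog (W₀ p μ : Matrix n n ℂ)‖ := norm_smul _ _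
        _ ≤ 1 * (2 * s₀) := mul_le_mul (by rw [abs_of_nonneg (hχ01 p).1]; exact (hχ01 p).2) (hlog_norm p μ hp) (norm_nonneg _) zero_le_one
        _ = 4 * ((d : ℝ) + 1) * ((R' : ℝ) + 1) * x := by rw [hs₀]; ring
    · have h0 : χ p = 0 := hχ0 p (by push Not at hp; linarith)
      simp only [h0, zero_smul, norm_zero]
      positivity
  · -- (iv) gradient
    intro p μ τ
    by_cases hp : D p ≤ (R' : ℤ)
    · have hp0 : D p ≤ (R' : ℤ) + 1 := hp.trans (by linarith)
      have hsplit : χ (p + e τ) • mlog (W₀ (p + e τ) μ : Matrix n n ℂ) - χ p • mlog (W₀ p μ : Matrix n n ℂ)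
          = χ (p + e τ) • (mlog (W₀ (p + e τ) μ : Matrix n n ℂ) - mlog (W₀ p μ : Matrix n n ℂ)) + (χ (p + e τ) - χ p) • mlog (W₀ p μ : Matrix n n ℂ) := by
        rw [smul_sub, sub_smul]; abel
      rw [hsplit]
      calc _ ≤ ‖χ (p + e τ) • (mlog (W₀ (p + e τ) μ : Matrix n n ℂ) - mlog (W₀ p μ : Matrix n n ℂ))‖ + ‖(χ (p + e τ) - χ p) • mlog (W₀ p μ : Matrix n n ℂ)‖ :=
            norm_add_le _ _
        _ = |χ (p + e τ)| * ‖mlog (W₀ (p + e τ) μ : Matrix n n ℂ) - mlog (W₀ p μ : Matrix n n ℂ)‖ + |χ (p + e τ) - χ p| * ‖mlog (W₀ p μ : Matrix n n ℂ)‖ := by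
            rw [norm_smul, norm_smul, Real.norm_eq_abs, Real.norm_eq_abs]
        _ ≤ 1 * (4 / 3 * g₁) + (1 / Mw) * (2 * s₀) :=
            add_le_add (mul_le_mul (by rw [abs_of_nonneg (hχ01 _).1]; exact (hχ01 _).2) (hlog_lip p μ τ hp) (norm_nonneg _) zero_le_one)
              (mul_le_mul (hχlip p τ) (hlog_norm p μ hp0) (norm_nonneg _) (by positivity))
        _ = _ := by rw [hs₀]; ring
    · push Not at hp
      have h0 : χ p = 0 := hχ0 p hp.le
      have h0' : χ (p + e τ) = 0 := hχ0 (p + e τ) (by have := (supDist_step_le y₀ p τ).2; linarith)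
      simp only [h0, h0', zero_smul, sub_zero, norm_zero]
      positivity
  · -- (v) exp on the inner cube
    intro p μ hp
    have hDp : D p ≤ (R' : ℤ) - Mw := hDge p _ hp
    have hp1 : D p ≤ (R' : ℤ) + 1 := hDp.trans (by linarith)
    simp only [hχ1 p hDp, one_smul]
    exact exp_mlog ((hsup p μ hp1).trans_lt (by linarith))

end

end Summit.QuantumFields.BalabanUV.T4Continuum.NE7AxialChartCube
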